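import Summits.CriticalPhenomena.SAWScalingLimit.Theorems.SAWLoopFugacityFlowIsingBoundaryRatioRadialKoebeChain
import Summits.CriticalPhenomena.SAWScalingLimit.Theorems.SAWLoopFugacityFlowIsingBoundaryRatioRadialGridPath
import Summits.CriticalPhenomena.SAWScalingLimit.Theorems.SAWLoopFugacityFlowIsingBoundaryRatioRadialChainGlue
import HarnessLib

/-!
# The radial crossing lower bound: the chart geometry of the bulk chain
(line `fk-anchor-transfer`, crux `IsingBoundaryRatio`, stmt-CriticalPhenomena-10650; helper file of the stub
`stub_halfAnnulusRadialCrossingBound`, RSW clause (iii))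

For the chordal chart `φ : ℍₒ → D` of a Dobrushin domain (`φ → a = D.pt 0` at `0`), `M > 1` and `ε > 0`, this
file produces the geometric input of the chart-free core `radial_mainBound`: a `ρ₀ > 0` such that for every
`ρ < ρ₀` and all small mesh `δ` there are an RSW unit `n ≥ 1` and a chain of lattice squares
`v i + [0, 4n]²`, `i ≤ L = K (8 · 1024^K + 3)`, `K = kSteps M`, consecutive squares equal or side-adjacent, all of
whose sites are GOOD — in the discrete domain `Ω_δ`, with mesh point in `B(a, ε)` and chart radius in
`(ρ/2, 2Mρ)`, and `Ω_δ`-adjacent to each of their lattice neighbours in `Ω_δ` — the first square having chart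
radius `< ρ` and the last `> Mρ` (`radial_geometry`). Construction: the centres `z_j = φ(w_j)`,
`w_j = i (3/4) ρ q^j` (`RadialChain.chainPt`), Koebe radii `r_j = im w_j |φ'(w_j)| / 32` with
`B(z_j, r_j) ⊆ φ(B(w_j, im w_j / 8))` (`RadialChain.ball_koebeRadius_subset`), consecutive centres within `r_j / 8`
and all radii within the factor `1024^K` of `r_lo = r_0 / 32^K` (`RadialChain.koebeRadius_uniform`); the unit
`n = ⌊r_lo / (64 δ)⌋`, so that squares have side `4 n δ ∈ [r_lo/32, r_lo/16]`; the chain is the grid path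
`RadialChain.gridCorner` through the centres, whose squares stay within `r_j / 2` of the centre of their segment
(`RadialChain.gridCorner_near`); lattice points of the compact set `⋃_j B̄(z_j, r_j/2) ⊆ D` are eventually in
`Ω_δ` (`JordanDomain.eventually_forall_mem_meshDomain'`). [folklore]
-/

noncomputable section

open scoped Classical Topology
open Set Metric Filter Complex
open Literature.Probability.LatticeModels Literature.Probability.RandomPlanarGeometry
open Literature.Probability.Percolation (zdGraph_adj_apply_le)
open UpperHalfPlane (upperHalfPlaneSet)

namespace Summit.CriticalPhenomena.SAWScalingLimit.Theorems.IsingBoundaryRatio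

namespace RadialChain

/-- Mesh points of lattice neighbours are within `2δ` (`δ > 0`). [folklore] -/
theorem dist_meshPoint_le_of_adj {δ : ℝ} (hδ : 0 < δ) {x y : Site 2} (h : (zdGraph 2).Adj x y) :
    dist (meshPoint δ y) (meshPoint δ x) ≤ 2 * δ := by
  rw [dist_eq_norm]
  refine (Complex.norm_le_abs_re_add_abs_im _).trans ?_
  have h0 := zdGraph_adj_apply_le h 0
  have h1 := zdGraph_adj_apply_le h 1
  simp only [Complex.sub_re, Complex.sub_im, meshPoint_re, meshPoint_im, ← mul_sub]
  rw [abs_mul, abs_mul, abs_of_pos hδ]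
  have e0 : |((y 0 : ℤ) : ℝ) - x 0| ≤ 1 := by
    rw [abs_le]; constructor <;> linarith [show ((y 0 : ℤ) : ℝ) ≤ x 0 + 1 by exact_mod_cast h0.1,
      show ((x 0 : ℤ) : ℝ) ≤ y 0 + 1 by exact_mod_cast h0.2]
  have e1 : |((y 1 : ℤ) : ℝ) - x 1| ≤ 1 := by
    rw [abs_le]; constructor <;> linarith [show ((y 1 : ℤ) : ℝ) ≤ x 1 + 1 by exact_mod_cast h1.1,
      show ((x 1 : ℤ) : ℝ) ≤ y 1 + 1 by exact_mod_cast h1.2]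
  nlinarith

/-- A point within `B₀` of `c` in each coordinate is within `2 B₀` of `c`. [folklore] -/
theorem dist_le_of_abs_re_im {p c : ℂ} {B₀ : ℝ} (h0 : |p.re - c.re| ≤ B₀) (h1 : |p.im - c.im| ≤ B₀) :
    dist p c ≤ 2 * B₀ := by
  rw [dist_eq_norm]
  refine (Complex.norm_le_abs_re_add_abs_im _).trans ?_
  rw [Complex.sub_re, Complex.sub_im]; linarith

end RadialChain

open RadialChain in
/-- **The chart geometry of the bulk chain** (registered sub-goal of stmt-CriticalPhenomena-10650, clause (iii)
helper; see the module docstring). [folklore] -/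
theorem radial_geometry : ∀ (D : DobrushinDomain) (φ : ConformalEquiv upperHalfPlaneSet D.carrier), D.IsChordalUniformizing φ → ∀ (M : ℝ), 1 < M → ∀ (ε : ℝ), 0 < ε → ∃ ρ₀ : ℝ, 0 < ρ₀ ∧ ∀ (ρ : ℝ), 0 < ρ → ρ < ρ₀ → ∀ᶠ δ in 𝓝[>] (0 : ℝ), ∃ (n : ℕ) (v : ℕ → Site 2), 1 ≤ n ∧ (∀ i < RadialChain.kSteps M * (8 * 1024 ^ RadialChain.kSteps M + 3), v (i + 1) = v i ∨ v (i + 1) = v i + ![((4 * n : ℕ) : ℤ), 0] ∨ v i = v (i + 1) + ![((4 * n : ℕ) : ℤ), 0] ∨ v (i + 1) = v i + ![(0 : ℤ), ((4 * n : ℕ) : ℤ)] ∨ v i = v (i + 1) + ![(0 : ℤ), ((4 * n : ℕ) : ℤ)]) ∧ (∀ i ≤ RadialChain.kSteps M * (8 * 1024 ^ RadialChain.kSteps M + 3), ∀ x ∈ RadialChain.boxSet (v i) (4 * n) (4 * n), x ∈ meshDomain D.carrier δ ∧ meshPoint δ x ∈ ball (D.pt 0) ε ∧ ρ / 2 < ‖φ.symm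 (meshPoint δ x)‖ ∧ ‖φ.symm (meshPoint δ x)‖ < 2 * M * ρ ∧ ∀ y ∈ meshDomain D.carrier δ, (zdGraph 2).Adj x y → (discreteDomainGraph D.carrier δ).Adj x y) ∧ (∀ x ∈ RadialChain.boxSet (v 0) (4 * n) (4 * n), ‖φ.symm (meshPoint δ x)‖ < ρ) ∧ (∀ x ∈ RadialChain.boxSet (v (RadialChain.kSteps M * (8 * 1024 ^ RadialChain.kSteps M + 3))) (4 * n) (4 * n), M * ρ < ‖φ.symm (meshPoint δ x)‖) := by
  intro D φ hφ M hM ε hε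
  have hM0 : 0 < M := one_pos.trans hM
  set f : ℂ → ℂ := ⇑φ with hfdef
  have hf : DifferentiableOn ℂ f upperHalfPlaneSet := φ.differentiableOn_coe
  have hinj : InjOn f upperHalfPlaneSet := φ.injOn
  -- the boundary value of `φ` at `0`
  obtain ⟨η, hη, hηε⟩ := Metric.tendsto_nhdsWithin_nhds.1 hφ.1 ε hε
  refine ⟨η / (2 * M), by positivity, fun ρ hρ hρ₀ => ?_⟩
  have h2Mρ : 2 * M * ρ < η := by rwa [lt_div_iff₀ (by positivity), mul_comm] at hρ₀
  -- the chain of centres and radii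
  set K := kSteps M with hK
  obtain ⟨hK1, hqK⟩ := kSteps_spec hM
  set P : ℕ := 8 * 1024 ^ K + 3 with hP
  set w : ℕ → ℂ := chainPt ρ with hw
  set z : ℕ → ℂ := fun j => f (w j) with hz
  set r : ℕ → ℝ := fun j => koebeRadius f (w j) with hr
  obtain ⟨hrlo, hrj⟩ := koebeRadius_uniform hf hinj hρ K
  set rlo := koebeRadius f (chainPt ρ 0) / 32 ^ K with hrlo_def
  have hwim : ∀ j, 0 < (w j).im := fun j => chainPt_im_pos hρ j
  -- the ball of radius `r j` about `z j`: chart preimages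
  have hball : ∀ j ≤ K, ∀ p ∈ ball (z j) (r j), p ∈ D.carrier ∧ p ∈ ball (D.pt 0) ε ∧
      ρ / 2 < ‖φ.symm p‖ ∧ ‖φ.symm p‖ < 2 * M * ρ ∧
      7 / 8 * ‖w j‖ < ‖φ.symm p‖ ∧ ‖φ.symm p‖ < 9 / 8 * ‖w j‖ := by
    intro j hj p hp
    obtain ⟨w', hw'im, hw'p, h78, h98, -⟩ := exists_preimage_of_mem_ball_koebeRadius hf hinj (hwim j) hp
    have hw'H : w' ∈ upperHalfPlaneSet := hw'im
    have hsymm : φ.symm p = w' := by rw [← hw'p]; exact φ.symm_apply_apply hw'H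
    obtain ⟨hlo, hhi, -, -⟩ := norm_chainPt_bounds hρ hM hj
    have hq : qRatio < 32 / 27 := by unfold qRatio; norm_num
    have hn2 : ‖w'‖ < 2 * M * ρ := by
      calc ‖w'‖ < 9 / 8 * ‖w j‖ := h98
        _ ≤ 9 / 8 * (3 / 2 * M * qRatio * ρ) := by gcongr
        _ < 9 / 8 * (3 / 2 * M * (32 / 27) * ρ) := by gcongr
        _ = 2 * M * ρ := by ring
    refine ⟨hw'p ▸ φ.mapsTo hw'H, ?_, by rw [hsymm]; linarith, by rw [hsymm]; exact hn2,
      by rw [hsymm]; exact h78, by rw [hsymm]; exact h98⟩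
    rw [← hw'p]
    exact hηε hw'H (by rw [dist_zero_right]; linarith)
  -- the compact set of the chain
  set Kc : Set ℂ := ⋃ j ∈ Finset.range (K + 1), closedBall (z j) (r j / 2) with hKc
  have hKcD : Kc ⊆ D.carrier := by
    intro p hp
    rw [hKc, mem_iUnion₂] at hp
    obtain ⟨j, hj, hpj⟩ := hp
    have hjK : j ≤ K := Nat.lt_succ_iff.1 (Finset.mem_range.1 hj)
    have hrpos : 0 < r j := hrlo.trans_le (hrj j hjK).1
    exact (hball j hjK p (closedBall_subset_ball (by linarith) hpj)).1
  have hKcc : IsCompact Kc := (Finset.range (K + 1)).isCompact_biUnion fun j _ => isCompact_closedBall _ _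
  have hev1 := D.toJordanDomain.eventually_forall_mem_meshDomain' hKcc hKcD
  have hev2 : ∀ᶠ δ in 𝓝[>] (0 : ℝ), δ < rlo / 128 :=
    mem_nhdsWithin_of_mem_nhds (Iio_mem_nhds (by positivity))
  filter_upwards [hev1, hev2, self_mem_nhdsWithin] with δ hδ1 hδ2 hδ0
  replace hδ1 := hδ1.1
  have hδpos : (0 : ℝ) < δ := hδ0
  -- the RSW unit
  set n : ℕ := ⌊rlo / (64 * δ)⌋₊ with hn
  have hn1 : 1 ≤ n := by
    rw [hn]; refine Nat.le_floor ?_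
    rw [Nat.cast_one, le_div_iff₀ (by positivity)]; linarith
  have hsδhi : (4 * n : ℕ) * δ ≤ rlo / 16 := by
    have := Nat.floor_le (show 0 ≤ rlo / (64 * δ) by positivity)
    rw [← hn] at this
    push_cast
    calc 4 * (n : ℝ) * δ ≤ 4 * (rlo / (64 * δ)) * δ := by gcongr
      _ = rlo / 16 := by field_simp; ring
  have hsδlo : rlo / 32 ≤ (4 * n : ℕ) * δ := by
    have := Nat.lt_floor_add_one (rlo / (64 * δ))
    rw [← hn] at this
    push_cast
    have h1 : rlo / (64 * δ) * δ = rlo / 64 := by field_simp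
    nlinarith
  have hsδ : 0 < ((4 * n : ℕ) : ℝ) * δ := by positivity
  -- the grid path
  have hdist : ∀ j < K, ‖z (j + 1) - z j‖ ≤ r j / 8 := fun j _ => norm_apply_chainPt_succ_sub_le hf hinj hρ j
  have hPj : ∀ j < K, 2 * (‖z (j + 1) - z j‖ / ((4 * n : ℕ) * δ) + 1) ≤ (P : ℝ) - 1 := by
    intro j hj
    have h1 : ‖z (j + 1) - z j‖ / ((4 * n : ℕ) * δ) ≤ 4 * 1024 ^ K := by
      rw [div_le_iff₀ hsδ]
      calc ‖z (j + 1) - z j‖ ≤ r j / 8 := hdist j hj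
        _ ≤ 1024 ^ K * rlo / 8 := by have := (hrj j hj.le).2; gcongr
        _ = 4 * 1024 ^ K * (rlo / 32) := by ring
        _ ≤ 4 * 1024 ^ K * ((4 * n : ℕ) * δ) := by gcongr
    rw [hP]; push_cast at h1 ⊢; linarith
  set v : ℕ → Site 2 := gridCorner z K δ (4 * n) P with hv
  refine ⟨n, v, hn1, fun i hi => gridCorner_step hsδ hPj i hi, fun i hi x hx => ?_, fun x hx => ?_, fun x hx => ?_⟩
  · -- good sites
    obtain ⟨j, hjK, hnear⟩ := gridCorner_near (c := z) (K := K) (P := P) hδpos hsδ i hi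
    obtain ⟨h0, h1⟩ := hnear x hx.1 hx.2.1 hx.2.2.1 hx.2.2.2
    have hE : (if j < K then ‖z (j + 1) - z j‖ else 0) + 2 * (4 * n : ℕ) * δ ≤ r j / 4 := by
      have hrjlo := (hrj j hjK).1
      split_ifs with hjK'
      · have := hdist j hjK'; push_cast at hsδhi ⊢; nlinarith
      · push_cast at hsδhi ⊢; nlinarith
    have hre : (meshPoint δ x).re = δ * x 0 := meshPoint_re δ x
    have him : (meshPoint δ x).im = δ * x 1 := meshPoint_im δ x
    have hdx : dist (meshPoint δ x) (z j) ≤ r j / 2 := by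
      have := dist_le_of_abs_re_im (p := meshPoint δ x) (c := z j) (B₀ := r j / 4)
        (by rw [hre]; exact h0.trans hE) (by rw [him]; exact h1.trans hE)
      linarith
    have hrpos : 0 < r j := hrlo.trans_le (hrj j hjK).1
    have hxball : meshPoint δ x ∈ ball (z j) (r j) := by rw [mem_ball]; linarith
    have hxKc : meshPoint δ x ∈ Kc := by
      rw [hKc, mem_iUnion₂]; exact ⟨j, Finset.mem_range.2 (Nat.lt_succ_of_le hjK), hdx⟩
    have hxmesh : x ∈ meshDomain D.carrier δ := hδ1 x hxKc
    obtain ⟨-, hxε, hρ2, h2M, -, -⟩ := hball j hjK _ hxball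
    refine ⟨hxmesh, hxε, hρ2, h2M, fun y hy hxy => ?_⟩
    -- the lattice edge `[δx, δy]` lies in the ball, hence in `D`
    have hyball : meshPoint δ y ∈ ball (z j) (r j) := by
      rw [mem_ball]
      have := dist_meshPoint_le_of_adj hδpos hxy
      have hδr : 2 * δ < r j / 2 := by have := (hrj j hjK).1; linarith
      linarith [dist_triangle (meshPoint δ y) (meshPoint δ x) (z j)]
    refine discreteDomainGraph_adj_iff.2 ⟨meshGraph_adj_iff.2 ⟨hxy, ?_⟩, hxmesh, hy⟩
    exact fun p hp => subset_closure ((hball j hjK p ((convex_ball (z j) (r j)).segment_subset hxball hyball hp)).1)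
  · -- the first square: chart radius `< ρ`
    have hKP : 0 < K * P := Nat.mul_pos hK1 (by rw [hP]; omega)
    obtain ⟨h0, h1⟩ := gridCorner_first_near (c := z) (K := K) (P := P) hδpos hsδ hKP x hx.1 hx.2.1 hx.2.2.1 hx.2.2.2
    have hdx : dist (meshPoint δ x) (z 0) ≤ 2 * (2 * (4 * n : ℕ) * δ) :=
      dist_le_of_abs_re_im (by rw [meshPoint_re]; exact h0) (by rw [meshPoint_im]; exact h1)
    have hr0 := (hrj 0 (Nat.zero_le _)).1
    have hxball : meshPoint δ x ∈ ball (z 0) (r 0) := by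
      rw [mem_ball]; push_cast at hsδhi hdx; nlinarith
    obtain ⟨-, -, -, -, -, h98⟩ := hball 0 (Nat.zero_le _) _ hxball
    obtain ⟨-, -, hw0, -⟩ := norm_chainPt_bounds hρ hM (Nat.zero_le K)
    calc ‖φ.symm (meshPoint δ x)‖ < 9 / 8 * ‖w 0‖ := h98
      _ = 9 / 8 * (3 / 4 * ρ) := by rw [hw0]
      _ < ρ := by linarith
  · -- the last square: chart radius `> M ρ`
    obtain ⟨h0, h1⟩ := gridCorner_last_near (c := z) (K := K) (P := P) hδpos hsδ x hx.1 hx.2.1 hx.2.2.1 hx.2.2.2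
    have hdx : dist (meshPoint δ x) (z K) ≤ 2 * (2 * (4 * n : ℕ) * δ) :=
      dist_le_of_abs_re_im (by rw [meshPoint_re]; exact h0) (by rw [meshPoint_im]; exact h1)
    have hrK := (hrj K le_rfl).1
    have hxball : meshPoint δ x ∈ ball (z K) (r K) := by
      rw [mem_ball]; push_cast at hsδhi hdx; nlinarith
    obtain ⟨-, -, -, -, h78, -⟩ := hball K le_rfl _ hxball
    obtain ⟨-, -, -, hwK⟩ := norm_chainPt_bounds hρ hM (le_refl K)
    calc M * ρ < 7 / 8 * (3 / 2 * M * ρ) := by nlinarith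
      _ ≤ 7 / 8 * ‖w K‖ := by gcongr
      _ < ‖φ.symm (meshPoint δ x)‖ := h78

end Summit.CriticalPhenomena.SAWScalingLimit.Theorems.IsingBoundaryRatio

end
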